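import Summits.BirchSwinnertonDyer.Rank1Residual.O5.O5CompanionTransport
import HarnessLib

/-!
# O5 — GEN 3, §4: GV2 — constancy of the KATO DEFECT across the ordinary and the supercuspidal point
# (research crux of route T-O5-GV, stated over an INTERFACE: Kato's `ℍ¹_Σ/z` and `ℍ²_Σ` are not tree
# objects yet), and the kernel assembly `kmc_of_companion`

This is §4 of o5-r1 GEN 3's `O5CompanionTransport.lean` (sha16 67db2651e7bd0fbb; planner-b2b-bsdres-o5-r1-g3-0,
2026-08-21), split off VERBATIM by the typer of record (cc-typer-5 GEN 4, ASK A-O5-15) only because the gate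
caps Theorems files at 400 lines; the module docstring of `O5.O5CompanionTransport` (G3-1, G3-2, G3-4 route
T-O5-GV with its cruxes GV1–GV3, G3-8) is the text of record for this section too and is not repeated.
HONEST FRAMING (o5-r1, verbatim): every node below is a `def … : Prop` (THEOREM-CANDIDATE with its printed
sources) or an `@[conjecture] def` (census-mined law / research crux); nothing is asserted, nothing booked,
census numbers are EVIDENCE; no main conjecture is an input of any certificate.  Cell `b2b-bsdres`, lane
CLASS-CLOSURE: 0 named Literature facts; the interface parameter `IsKatoDatumOf` is a section `variable`
(definition request D-O5-GV-1), never a hypothesis smuggled into a certificate; no mark of `RESIDUAL-MAP.md`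
moves.  Details: `HOME/cells/o5o6/TARGETS.md` §O5 '#### o5-r1 GEN 3' (G3-4, G3-6).
[cite: Kim2019KatoInvariants, Thm. 2.1 and §7] [cite: Kato2004Asterisque, Thm. 12.4 p. 221, Thm. 12.5 pp. 221–222, Conj. 12.10 p. 224]
[cite: EmertonPollackWeston2006, Thm. 1](cc-typer-5 GEN 4 doc-only hygiene pass, lit-kato GEN 12 note 3: the interim stub key `Kato2004` replaced by the
references.bib key `Kato2004Asterisque` with page locators; no declaration or statement changed.)
-/

set_option autoImplicit false

noncomputable section

open scoped Classical MatrixGroups ModularForm NumberField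

open CongruenceSubgroup Polynomial WeierstrassCurve NumberField Literature.NumberTheory.EllipticCurves
  Literature.NumberTheory.EllipticCurves.ModularForms
  Summit.BirchSwinnertonDyer.Rank1Residual.Additive

namespace Summit.BirchSwinnertonDyer.Rank1Residual.O5

/-! ## §4 GV2 — constancy of the KATO DEFECT across the ordinary and the supercuspidal point (research crux,
## stated over an INTERFACE: Kato's `ℍ¹_Σ/z` and `ℍ²_Σ` are not tree objects yet) -/

/-- The four Iwasawa invariants, per branch `ε`, of Kato's `Σ`-imprimitive cohomology of a weight-2 cusp
form at `3`: `λ, μ` of `ℍ²_Σ = H²(ℤ[1/Σ], T_f ⊗ Λ)^{(ε)}` and of `ℍ¹_Σ/z_f` (`z_f` = Kato's `Σ`-depleted zeta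
element).  The structure only NAMES numbers; "`D` IS the Kato datum of `(f, Σ)`" is the interface parameter
`IsKatoDatumOf` (a definition request, never smuggled: existence / torsionness is Kato Thm 12.4).
[cite: Kato2004Asterisque, Thm. 12.4 p. 221, Thm. 12.5 pp. 221–222, Conj. 12.10 p. 224] -/
structure KatoIwasawaInvariants where
  /-- `λ(ℍ²_Σ^{(ε)})` -/
  lamH2 : Bool → ℕ
  /-- `μ(ℍ²_Σ^{(ε)})` -/
  muH2 : Bool → ℕ
  /-- `λ((ℍ¹_Σ/z_f)^{(ε)})` -/
  lamH1z : Bool → ℕ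
  /-- `μ((ℍ¹_Σ/z_f)^{(ε)})` -/
  muH1z : Bool → ℕ

/-- The **Kato defect** on branch `ε`: `δ^ε(f) = λ(ℍ¹_Σ/z_f) − λ(ℍ²_Σ)` (`≥ 0` and, granted `μ = 0` on both
sides, `= 0` iff Kato's main conjecture holds on that branch — Kato Thm 12.5 gives the divisibility
`char ℍ² ∣ char ℍ¹/z` under the big-image hypothesis, with no hypothesis on the reduction at `3`).
[cite: Kato2004Asterisque, Thm. 12.5 (4) pp. 221–222] -/
def katoDefect (D : KatoIwasawaInvariants) (ε : Bool) : ℤ :=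
  (D.lamH1z ε : ℤ) - D.lamH2 ε

section Interface

/- INTERFACE (definition request D-O5-GV-1, `cells/o5o6/TARGETS.md` §O5 G3-6): `IsKatoDatumOf f Σ D` =
"the four fields of `D` ARE the invariants of Kato's `Σ`-imprimitive `ℍ²` and `ℍ¹/z` of `f` at `3`". -/
variable (IsKatoDatumOf : ∀ {N : ℕ}, CuspForm (Gamma0 N) 2 → Finset ℕ → KatoIwasawaInvariants → Prop)

/-- **GV2 `KatoDefectConstancyThree` (RESEARCH CRUX of route T-O5-GV; OBJECT-CANDIDATE — C.-H. Kim's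
Thm 2.1 (2)–(3) with the hypothesis `p ∤ N` removed at the tame potentially-crystalline point).**  For a
generic type-III* O5b curve `W` with big image and an ordinary elliptic companion `G`, and `Σ` containing
the primes of `N_W N_G`: if `μ = 0` for `G` on branch `ε` (known from `μ(L₃(G)) = 0` by certified numerics +
Kato), then `μ = 0` for `W` on that branch AND the Kato defects agree: `δ^ε(f_W) = δ^ε(f_G)`.  Why it might
fail: the mod-3 zeta elements of `f_W` and `f_G` in `ℍ¹_Σ(ρ̄ ⊗ Λ)^{(ε)} ≅ 𝔽₃⟦T⟧` differ by `T^d·unit`, and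
Kim pins `d` by mod-`p` multiplicity one of `H¹(X₁(N))_𝔪` at the common level, which is FALSE at `9 ∥ N` with
`U₃ ∈ 𝔪` (o5-r2's F-O5-M2: multiplicity two); so `d` must be computed through the multiplicity-two
structure — in print neither for `p ∣ N` supercuspidal (Kim §7 treats only semistable ordinary `p ∣ N`) nor at
`p = 3` (Nakamura).  Census shadow: T14 (`κ` universal ⟺ `d` constant).  Stated over the interface.
[cite: Kim2019KatoInvariants, Thm. 2.1 and §7] [cite: Kato2004Asterisque, Thm. 12.5 pp. 221–222] [cite: EmertonPollackWeston2006, Thm. 1] -/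
@[conjecture] def KatoDefectConstancyThree : Prop :=
  ∀ (W G : WeierstrassCurve ℚ) [W.IsElliptic] [W.IsGloballyMinimal] [NeZero (W.conductorNorm ℤ)]
    [G.IsElliptic] [G.IsGloballyMinimal] [NeZero (G.conductorNorm ℤ)]
    (f : CuspForm (Gamma0 (W.conductorNorm ℤ)) 2) (g : CuspForm (Gamma0 (G.conductorNorm ℤ)) 2)
    (S : Finset ℕ) (DW DG : KatoIwasawaInvariants),
    IsNewformOf W f → IsNewformOf G g → ClassO5 W 3 → SubTprime W 3 → padicValRat 3 W.Δ = 9 →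
    Kato2004.ImageContainsSL2 W 3 → ¬ LocIrr W 3 → IsCompanionAtThree W G → ¬ ((3 : ℤ) ∣ G.LFunction 3) →
    (W.conductorNorm ℤ * G.conductorNorm ℤ).primeFactors ⊆ S → IsKatoDatumOf f S DW → IsKatoDatumOf g S DG →
    ∀ ε : Bool, DG.muH2 ε = 0 → DG.muH1z ε = 0 →
      DW.muH2 ε = 0 ∧ DW.muH1z ε = 0 ∧ katoDefect DW ε = katoDefect DG ε

/-- **Assembly of route T-O5-GV (kernel bookkeeping over the interface; nothing asserted).**  GIVEN, as
explicit hypotheses: (i) the interface reading of Kato's main conjecture for elliptic curves through a Kato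
datum with `Σ ⊇` primes of the conductor — `KMC E 3` iff on both branches `μ(ℍ²) = μ(ℍ¹/z)` and the defect
vanishes (Kato 12.10 ⟺ its `Σ`-imprimitive form by Euler-factor bookkeeping at `ℓ ≠ 3`; `hread`);
(ii) a Kato datum exists for every `(f, Σ)` (Kato Thm 12.4; `hdat`); (iii) `KatoDefectConstancyThree`;
(iv) KMC for the ordinary companion `G` (Kato 12.5 + Skinner–Urban 3.29 where its hypotheses hold at `3`;
`hG`) with `μ = 0` for `G` (`hμ`) — THEN `KMC W 3` for the generic type-III* O5b curve `W`.  With the tree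
shell `PotSupersingularLowerHalfRankZeroOfKMC KMC` (O5Targets) this is the r0 LOWER half at `3` for `W`.
[folklore] -/
theorem kmc_of_companion
    (KMC : ∀ (W : WeierstrassCurve ℚ) [W.IsElliptic] [W.IsGloballyMinimal] (p : ℕ), Prop)
    (hread : ∀ (E : WeierstrassCurve ℚ) [E.IsElliptic] [E.IsGloballyMinimal] [NeZero (E.conductorNorm ℤ)]
      (f : CuspForm (Gamma0 (E.conductorNorm ℤ)) 2) (S : Finset ℕ) (D : KatoIwasawaInvariants),
      IsNewformOf E f → (E.conductorNorm ℤ).primeFactors ⊆ S → IsKatoDatumOf f S D →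
        (KMC E 3 ↔ ∀ ε : Bool, D.muH2 ε = D.muH1z ε ∧ katoDefect D ε = 0))
    (hdat : ∀ {N : ℕ} (f : CuspForm (Gamma0 N) 2) (S : Finset ℕ), ∃ D, IsKatoDatumOf f S D)
    (hGV2 : KatoDefectConstancyThree IsKatoDatumOf)
    (W G : WeierstrassCurve ℚ) [W.IsElliptic] [W.IsGloballyMinimal] [NeZero (W.conductorNorm ℤ)]
    [G.IsElliptic] [G.IsGloballyMinimal] [NeZero (G.conductorNorm ℤ)]
    (f : CuspForm (Gamma0 (W.conductorNorm ℤ)) 2) (g : CuspForm (Gamma0 (G.conductorNorm ℤ)) 2)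
    (hf : IsNewformOf W f) (hg : IsNewformOf G g) (h5 : ClassO5 W 3) (hT : SubTprime W 3)
    (hΔ : padicValRat 3 W.Δ = 9) (himg : Kato2004.ImageContainsSL2 W 3) (hgen : ¬ LocIrr W 3)
    (hcomp : IsCompanionAtThree W G) (hord : ¬ ((3 : ℤ) ∣ G.LFunction 3))
    (hG : KMC G 3)
    (hμ : ∀ (S : Finset ℕ) (D : KatoIwasawaInvariants), (G.conductorNorm ℤ).primeFactors ⊆ S →
      IsKatoDatumOf g S D → ∀ ε : Bool, D.muH2 ε = 0 ∧ D.muH1z ε = 0) :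
    KMC W 3 := by
  classical
  set S : Finset ℕ := (W.conductorNorm ℤ * G.conductorNorm ℤ).primeFactors with hS
  have hW0 : (W.conductorNorm ℤ) ≠ 0 := NeZero.ne _
  have hG0 : (G.conductorNorm ℤ) ≠ 0 := NeZero.ne _
  have hSW : (W.conductorNorm ℤ).primeFactors ⊆ S := by
    rw [hS]; exact Nat.primeFactors_mono (dvd_mul_right _ _) (mul_ne_zero hW0 hG0)
  have hSG : (G.conductorNorm ℤ).primeFactors ⊆ S := by
    rw [hS]; exact Nat.primeFactors_mono (dvd_mul_left _ _) (mul_ne_zero hW0 hG0)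
  obtain ⟨DW, hDW⟩ := hdat f S
  obtain ⟨DG, hDG⟩ := hdat g S
  have hGread := (hread G g S DG hg hSG hDG).1 hG
  refine (hread W f S DW hf hSW hDW).2 fun ε => ?_
  have hμG := hμ S DG hSG hDG ε
  obtain ⟨h1, h2, h3⟩ := hGV2 W G f g S DW DG hf hg h5 hT hΔ himg hgen hcomp hord subset_rfl hDW hDG ε hμG.1 hμG.2
  refine ⟨by rw [h1, h2], ?_⟩
  rw [h3]; exact (hGread ε).2

end Interface

end Summit.BirchSwinnertonDyer.Rank1Residual.O5

end
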